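import Summits.ResolutionOfSingularities.ResolutionOfSingularities.Theorems.FrobeniusLadderFInjectiveMacaulayficationFInjectiveMacaulayficationDimFour
import Summits.ResolutionOfSingularities.ResolutionOfSingularities.Theorems.FrobeniusLadderFInjectiveMacaulayficationReductions
import Literature.AlgebraicGeometry.Resolution.BlowupsIntegral
import Literature.AlgebraicGeometry.Resolution.BlowupsProperProofs
import HarnessLib

/-!
# The crux from «CP below dimension 4 + a FULL blow-up model in dimension ≥ 4» — the name-independent half of the LOCAL DOOR assembly (E6)
# (crux `FInjectiveMacaulayfication` stmt-ResolutionOfSingularities-15315, chain w45a; res-L1-w45a-plan-1 RULING R17.4 (E6) `…OfLocalDoor`: this file is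
# its glue, written BEFORE the local-door statements (E2) `LocalResolutionNonClosedGe4` / (E3) `LocalFullificationFibreGe4` and the F-Temkin engine
# (E5) `exists_isBlowup_full_of_LFfibre` land — they enter only through the hypothesis `FullBlowupGe4` below; seat res-L1-w45a-stub-1 g7)

[OURS · L1 W4.5a] Support file (`--supports stmt-ResolutionOfSingularities-15315 --as helper`); replaces the role of NO printed item; NOT a statement of the
manuscript; def-free; CONDITIONAL on `CossartPiltant2019General` (CP 2019 Thm. 1.1 (i)(ii)) BY NAME for dimension
`≤ 3`; AI-written (AI review is weaker than expert review).

* THE INPUT SHAPE «FullBlowupGe4» (spelled out as a hypothesis, no def): every integral separated finite-type `X/k` (`char k = p`) of dimension `≥ 4` has a blowing up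
  `X″ → X` along some `J″ ≠ ⊥` with ALL stalks of `X″` FULL (domain ∧ Cohen–Macaulay ∧ F-closed parameter ideals, `SliceableCentre.FullCl`). This is
  exactly what the local door delivers ((E5): F-Temkin at the closed points of the top dimension over THEOREM A-gen; on 4-folds already
  `FTemkinClosedPointsFibre.exists_isBlowup_full_of_L4fibre`).
* `fiModel_integral_of_fullBlowupGe4 (hG) (h : «FullBlowupGe4 p»)`: the crux's INTEGRAL FORM for every integral `X` — dimension `≤ 3` by Cossart–Piltant
  outright (`FInjectiveMacaulayficationDimFour.fiModel_integral_of_dim_le_three`), dimension `≥ 4` by `h` (a blowing up along `J″ ≠ ⊥` of an integral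
  scheme is proper, birational, with integral source).
* `exists_fiModel_of_fullBlowupGe4` (reduced `X`, instance binders) and `fInjectiveMacaulayfication_text_of_fullBlowupGe4 (hG) (h : ∀ p, p.Prime →
  «FullBlowupGe4 p»)` = THE CRUX'S ∀-TEXT VERBATIM with NO dimension binder (reduced `X` ↦ integral components, `exists_fiModel_of_integralForm`), and
  `fInjectiveMacaulayfication_of_fullBlowupGe4` = the route decl itself (by `δ`). The local door (E6) is then the one-liner
  `fInjectiveMacaulayfication_of_fullBlowupGe4 hG (fun p hp k … => E5 …)`.
[folklore assembly; cite: CossartPiltant2019, Thm. 1.1 (i)(ii); proof of Prop. 4.6 Step 1] [cite: StacksProject, Tag 02ND; Tag 01OF]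
-/

-- single-problem summit: the doubled namespace component is forced
set_option linter.dupNamespace false

noncomputable section

namespace Summit.ResolutionOfSingularities.ResolutionOfSingularities.Theorems.FInjectiveMacaulayfication.OfFullBlowupGe4

open CategoryTheory CategoryTheory.Limits AlgebraicGeometry TopologicalSpace IsLocalRing
open Literature.AlgebraicGeometry.Resolution
open Summit.ResolutionOfSingularities.ResolutionOfSingularities.Theorems.FInjectiveMacaulayfication
open SliceableCentre

/-- `¬ d ≤ 3 → 4 ≤ d` in `WithBot ℕ∞`. [plumbing] -/
theorem four_le_of_not_le_three {d : WithBot ℕ∞} (h : ¬ d ≤ 3) : 4 ≤ d := by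
  induction d using WithBot.recBotCoe with
  | bot => exact absurd bot_le h
  | coe a =>
    induction a using ENat.recTopCoe with
    | top => rw [← WithBot.coe_ofNat, WithBot.coe_le_coe]; exact le_top
    | coe n =>
      have hn : ¬ n ≤ 3 := fun hle => h (WithBot.coe_le_coe.mpr (by exact_mod_cast hle))
      rw [← WithBot.coe_ofNat, WithBot.coe_le_coe]
      exact_mod_cast (show 4 ≤ n by omega)

/-- **The crux's integral form from CP below dimension 4 and a FULL blow-up model in dimension ≥ 4.** [OURS · conditional-result]
[cite: CossartPiltant2019, Thm. 1.1 (i)(ii)] -/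
theorem fiModel_integral_of_fullBlowupGe4 (hG : CossartPiltant2019General.{0})
    (p : ℕ) [hp : Fact p.Prime]
    (h : (∀ (k : Type) [Field k] [CharP k p] (X : Scheme.{0}) (f : X ⟶ Spec (.of k)),
      IsSeparated f → LocallyOfFiniteType f → QuasiCompact f → IsIntegral X → (4 : WithBot ℕ∞) ≤ topologicalKrullDim X →
      ∃ (X'' : Scheme.{0}) (f'' : X'' ⟶ X) (J'' : X.IdealSheafData), IsBlowup f'' J'' ∧ J'' ≠ ⊥ ∧
        ∀ x'' : X'', FullCl p (X''.presheaf.stalk x'')))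
    (k : Type) [Field k] [CharP k p] (X : Scheme.{0}) (f : X ⟶ Spec (.of k))
    [IsSeparated f] [LocallyOfFiniteType f] [QuasiCompact f] [IsIntegral X] :
    ∃ (X' : Scheme.{0}) (π : X' ⟶ X), IsProper π ∧ IsBirational π ∧ IsIntegral X' ∧ ∀ x : X', FullCl p (X'.presheaf.stalk x) := by
  by_cases h3 : topologicalKrullDim X ≤ 3
  · exact FInjectiveMacaulayficationDimFour.fiModel_integral_of_dim_le_three hG p k X f h3
  · haveI : IsLocallyNoetherian X := LocallyOfFiniteType.isLocallyNoetherian f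
    obtain ⟨X'', f'', J'', hf'', hJ'', hfull⟩ :=
      h k X f inferInstance inferInstance inferInstance inferInstance (four_le_of_not_le_three h3)
    haveI : IsIntegral X'' := hf''.isIntegral hJ''
    exact ⟨X'', f'', hf''.isProper, hf''.isBirational' hJ'', inferInstance, hfull⟩

/-- **The crux's conclusion for a given REDUCED `X`** (instance-binder form) from CP below dimension 4 and FULL blow-up models in dimension ≥ 4:
integral components glued (`exists_fiModel_of_integralForm`). [OURS · conditional-result] [cite: CossartPiltant2019, Thm. 1.1 (i)(ii); proof of Prop. 4.6 Step 1] -/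
theorem exists_fiModel_of_fullBlowupGe4 (hG : CossartPiltant2019General.{0})
    (p : ℕ) [Fact p.Prime]
    (h : (∀ (k : Type) [Field k] [CharP k p] (X : Scheme.{0}) (f : X ⟶ Spec (.of k)),
      IsSeparated f → LocallyOfFiniteType f → QuasiCompact f → IsIntegral X → (4 : WithBot ℕ∞) ≤ topologicalKrullDim X →
      ∃ (X'' : Scheme.{0}) (f'' : X'' ⟶ X) (J'' : X.IdealSheafData), IsBlowup f'' J'' ∧ J'' ≠ ⊥ ∧
        ∀ x'' : X'', FullCl p (X''.presheaf.stalk x'')))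
    (k : Type) [Field k] [CharP k p] (X : Scheme.{0}) (f : X ⟶ Spec (.of k))
    [IsSeparated f] [LocallyOfFiniteType f] [QuasiCompact f] [IsReduced X] :
    ∃ (X' : Scheme.{0}) (π : X' ⟶ X), IsProper π ∧ IsBirational π ∧ ∀ x : X',
      IsDomain (X'.presheaf.stalk x) ∧ ∀ d : ℕ, ringKrullDim (X'.presheaf.stalk x) = d →
        ∀ s : Fin d → X'.presheaf.stalk x, (Ideal.span (Set.range s)).radical.IsMaximal →
          RingTheory.Sequence.IsWeaklyRegular (X'.presheaf.stalk x) (List.ofFn s) ∧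
          ∀ y : X'.presheaf.stalk x, (∃ e : ℕ, y ^ p ^ e ∈ Ideal.span
            ((fun z : X'.presheaf.stalk x => z ^ p ^ e) ''
              (Ideal.span (Set.range s) : Set (X'.presheaf.stalk x)))) →
            y ∈ Ideal.span (Set.range s) :=
  exists_fiModel_of_integralForm p k
    (fun Y g hs hl hq hi => by
      haveI := hs; haveI := hl; haveI := hq; haveI := hi
      exact fiModel_integral_of_fullBlowupGe4 hG p h k Y g)
    X f

/-- **★ THE CRUX'S ∀-TEXT VERBATIM** (`Theses.FrobeniusLadder.FInjectiveMacaulayfication` unfolded, NO dimension binder) from CP below dimension 4 and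
FULL blow-up models in dimension ≥ 4 for every prime `p`. [OURS · conditional-result] [cite: CossartPiltant2019, Thm. 1.1 (i)(ii); proof of Prop. 4.6 Step 1] -/
theorem fInjectiveMacaulayfication_text_of_fullBlowupGe4 (hG : CossartPiltant2019General.{0})
    (h : ∀ p : ℕ, p.Prime → (∀ (k : Type) [Field k] [CharP k p] (X : Scheme.{0}) (f : X ⟶ Spec (.of k)),
        IsSeparated f → LocallyOfFiniteType f → QuasiCompact f → IsIntegral X → (4 : WithBot ℕ∞) ≤ topologicalKrullDim X →
        ∃ (X'' : Scheme.{0}) (f'' : X'' ⟶ X) (J'' : X.IdealSheafData), IsBlowup f'' J'' ∧ J'' ≠ ⊥ ∧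
          ∀ x'' : X'', FullCl p (X''.presheaf.stalk x''))) :
    ∀ p : ℕ, p.Prime → ∀ (k : Type) [Field k] [CharP k p] (X : Scheme.{0}) (f : X ⟶ Spec (.of k)),
      IsSeparated f → LocallyOfFiniteType f → QuasiCompact f → IsReduced X →
      ∃ (X' : Scheme.{0}) (π : X' ⟶ X), IsProper π ∧ IsBirational π ∧ ∀ x : X',
        IsDomain (X'.presheaf.stalk x) ∧ ∀ d : ℕ, ringKrullDim (X'.presheaf.stalk x) = d →
          ∀ s : Fin d → X'.presheaf.stalk x, (Ideal.span (Set.range s)).radical.IsMaximal →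
            RingTheory.Sequence.IsWeaklyRegular (X'.presheaf.stalk x) (List.ofFn s) ∧
            ∀ y : X'.presheaf.stalk x, (∃ e : ℕ, y ^ p ^ e ∈ Ideal.span
              ((fun z : X'.presheaf.stalk x => z ^ p ^ e) ''
                (Ideal.span (Set.range s) : Set (X'.presheaf.stalk x)))) →
              y ∈ Ideal.span (Set.range s) := by
  intro p hp k _ _ X f hsep hft hqc hred
  haveI : Fact p.Prime := ⟨hp⟩
  haveI := hsep
  haveI := hft
  haveI := hqc
  haveI := hred
  exact exists_fiModel_of_fullBlowupGe4 hG p (h p hp) k X f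

/-- **★ THE ROUTE DECL ITSELF** from CP below dimension 4 and FULL blow-up models in dimension ≥ 4 (the ∀-text theorem, by `δ`).
[OURS · conditional-result] [cite: CossartPiltant2019, Thm. 1.1 (i)(ii)] -/
theorem fInjectiveMacaulayfication_of_fullBlowupGe4 (hG : CossartPiltant2019General.{0})
    (h : ∀ p : ℕ, p.Prime → (∀ (k : Type) [Field k] [CharP k p] (X : Scheme.{0}) (f : X ⟶ Spec (.of k)),
        IsSeparated f → LocallyOfFiniteType f → QuasiCompact f → IsIntegral X → (4 : WithBot ℕ∞) ≤ topologicalKrullDim X →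
        ∃ (X'' : Scheme.{0}) (f'' : X'' ⟶ X) (J'' : X.IdealSheafData), IsBlowup f'' J'' ∧ J'' ≠ ⊥ ∧
          ∀ x'' : X'', FullCl p (X''.presheaf.stalk x''))) :
    Summit.ResolutionOfSingularities.ResolutionOfSingularities.Theses.FrobeniusLadder.FInjectiveMacaulayfication :=
  fInjectiveMacaulayfication_text_of_fullBlowupGe4 hG h

end Summit.ResolutionOfSingularities.ResolutionOfSingularities.Theorems.FInjectiveMacaulayfication.OfFullBlowupGe4

end
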